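import Summits.CriticalPhenomena.SAWScalingLimit.Theorems.SAWLeftRightFKGFKGToTraversalBoundBBRefineStep
import HarnessLib

/-!
# Body refinement of a site set, part 2: the fine tour simulates the coarse tour

Crux `SAWLeftRightFKG.FKGToTraversalBound` (stmt-CriticalPhenomena-1878), line `slit-necklace`, lead
prover-line-stmt-CriticalPhenomena-1878-c5-0; boundary-budget unit U6, sub-unit BB3 (body refinement), on top of
`…BBRefineStep` (`bbt_step`: one-step simulation; `bbt_isBEdge_scale`; `bbt_line_unique`) and `…OutlineTour`
(`btour_add`, `btour_isBEdge`).

Registered stub `bb_refine_tour`: for the fine body `A` of the coarse site set `B` at scale `M ≥ 2` and a boundary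
edge `e` of `B` with injective tour period `N`, there is a strictly increasing position map `Φ` with `Φ 0 = 0`
such that the wall-follower tour of `A` from the scaled edge `(M • e.1, e.2)` sits at the scaled coarse tour edge
`btour B e n` at time `Φ n`, returns at time `Φ N`, and is injective on `[0, Φ N)`.

* `bbt_nocollide` — the fine edges listed by `bbt_step` for distinct (coarse boundary edge, offset) pairs are
  distinct (the fine site determines the coarse edge by division with remainder);
* `bb_refine_tour` — `Φ n = L₀ + ⋯ + L_{n-1}` with the step lengths `Lᵢ` of `bbt_step`; simulation by induction
  (`btour_add`), injectivity from `bbt_nocollide` and the injectivity of the coarse period.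

All statements folklore (boundary tracing of a polyomino and of its refinement); no literature fact; nothing
restates the crux.
-/

noncomputable section

open Literature.Probability.LatticeModels

namespace Summit.CriticalPhenomena.SAWScalingLimit.Theorems.FKGToTraversalBound.SlitNecklace

/-- **No collisions between simulated steps.**  The fine edge at offset `r` of the simulated step from the coarse
boundary edge `(x, d)` (arm edge `(M • x + r • d.ccw, d)` for `r < M`, second-arm edge
`(M • (x + d.ccw) + (r - M + 1) • d, d.cw)` for `M ≤ r < 2M - 1`) determines `(x, d)` and `r`. [folklore] -/
theorem bbt_nocollide {B : Finset (Site 2)} {M : ℕ} {x x' : Site 2} {d d' : ODir} {r r' : ℕ}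
    (he : IsBEdge (↑B : Set (Site 2)) (x, d)) (he' : IsBEdge (↑B : Set (Site 2)) (x', d'))
    (hr : r < 2 * M - 1) (hr' : r' < 2 * M - 1)
    (h : (if r < M then ((M : ℤ) • x + (r : ℤ) • d.ccw.vec, d)
        else ((M : ℤ) • (x + d.ccw.vec) + ((r : ℤ) - M + 1) • d.vec, d.cw)) =
      (if r' < M then ((M : ℤ) • x' + (r' : ℤ) • d'.ccw.vec, d')
        else ((M : ℤ) • (x' + d'.ccw.vec) + ((r' : ℤ) - M + 1) • d'.vec, d'.cw))) :
    x = x' ∧ d = d' ∧ r = r' := by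
  obtain ⟨hx, hxd⟩ := he
  obtain ⟨hx', hxd'⟩ := he'
  simp only [Finset.mem_coe] at hx hxd hx' hxd'
  by_cases h1 : r < M <;> by_cases h2 : r' < M
  · rw [if_pos h1, if_pos h2] at h
    obtain ⟨hs, rfl⟩ := Prod.mk.inj h
    obtain ⟨hxx, hrr⟩ := bbt_line_unique d.ccw (by positivity) (by omega) (by positivity) (by omega) hs
    exact ⟨hxx, rfl, by exact_mod_cast hrr⟩
  · rw [if_pos h1, if_neg h2] at h
    obtain ⟨hs, hd⟩ := Prod.mk.inj h
    obtain rfl : d' = d.ccw := by rw [hd, ODir.ccw_cw]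
    rw [ODir.vec_ccw_ccw] at hs
    obtain ⟨rfl, -⟩ := bbt_line_unique d.ccw (by positivity) (by omega) (by omega) (by omega) hs
    exact absurd (by simpa using hx') hxd
  · rw [if_neg h1, if_pos h2] at h
    obtain ⟨hs, rfl⟩ := Prod.mk.inj h
    rw [ODir.ccw_cw] at hs
    obtain ⟨rfl, -⟩ := bbt_line_unique d (by omega) (by omega) (by positivity) (by omega) hs
    have : x + d.ccw.vec + d.cw.vec = x := by rw [ODir.vec_cw]; abel
    rw [this] at hxd'
    exact absurd hx hxd'
  · rw [if_neg h1, if_neg h2] at h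
    obtain ⟨hs, hd⟩ := Prod.mk.inj h
    obtain rfl : d = d' := by simpa using congrArg ODir.ccw hd
    obtain ⟨hxx, hrr⟩ := bbt_line_unique d (by omega) (by omega) (by omega) (by omega) hs
    exact ⟨add_right_cancel hxx, rfl, by omega⟩

/-- **Registered stub `bb_refine_tour`: the fine tour simulates the coarse tour.**  With the step lengths
`Lᵢ ∈ {1, M, 2M - 1}` of `bbt_step` along the coarse tour, `Φ n := L₀ + ⋯ + L_{n-1}` is strictly increasing,
the fine tour from `(M • e.1, e.2)` sits at the scaled coarse edge `btour B e n` at time `Φ n` (induction,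
`btour_add`), returns at `Φ N`, and is injective on `[0, Φ N)`: a time `j < Φ N` is `Φ n + r` with `n < N`,
`r < L_n`, the fine edge there is the offset-`r` edge of the step from `btour B e n` (`bbt_step`), which determines
`btour B e n` and `r` (`bbt_nocollide`), hence `n` by injectivity of the coarse period. [folklore] -/
theorem bb_refine_tour : ∀ (B A : Finset (Site 2)) (M : ℕ) (e : Site 2 × ODir) (N : ℕ), 2 ≤ M → (∀ f : Site 2, f ∈ A ↔ ((∃ x ∈ B, f = (M : ℤ) • x) ∨ (∃ x ∈ B, ∃ d : ODir, x + d.vec ∈ B ∧ ∃ t : ℤ, 0 < t ∧ t < M ∧ f = (M : ℤ) • x + t • d.vec) ∨ (∃ x ∈ B, x + ODir.vec 0 ∈ B ∧ x + ODir.vec 1 ∈ B ∧ x + ODir.vec 0 + ODir.vec 1 ∈ B ∧ ∃ t₁ t₂ : ℤ, 0 < t₁ ∧ t₁ < M ∧ 0 < t₂ ∧ t₂ < M ∧ f = (M : ℤ) • x + t₁ • ODir.vec 0 + t₂ • ODir.vec 1))) → IsBEdge (↑B : Set (Site 2)) e → 0 < N → btour (↑B : Set (Site 2)) e N = e → (∀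 j j', j < N → j' < N → btour (↑B : Set (Site 2)) e j = btour (↑B : Set (Site 2)) e j' → j = j') → ∃ Φ : ℕ → ℕ, Φ 0 = 0 ∧ StrictMono Φ ∧ IsBEdge (↑A : Set (Site 2)) ((M : ℤ) • e.1, e.2) ∧ (∀ n, btour (↑A : Set (Site 2)) ((M : ℤ) • e.1, e.2) (Φ n) = ((M : ℤ) • (btour (↑B : Set (Site 2)) e n).1, (btour (↑B : Set (Site 2)) e n).2)) ∧ btour (↑A : Set (Site 2)) ((M : ℤ) • e.1, e.2) (Φ N) = ((M : ℤ) • e.1, e.2) ∧ (∀ j j', j < Φ N → j' < Φ N → btour (↑A : Set (Site 2)) ((M : ℤ) • e.1, e.2) j = btour (↑A : Set (Site 2)) ((M : ℤ) • e.1, e.2) j' → j = j') := by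
  intro B A M e N hM hA he hN hper hinj
  -- the coarse tour edges are boundary edges; attach the step data of `bbt_step` to each of them
  have hBE : ∀ n, IsBEdge (↑B : Set (Site 2))
      ((btour (↑B : Set (Site 2)) e n).1, (btour (↑B : Set (Site 2)) e n).2) :=
    fun n => btour_isBEdge _ he n
  choose L hL0 hLle hLend hLrun using
    fun n => bbt_step B A M hM hA (btour (↑B : Set (Site 2)) e n).1 (btour (↑B : Set (Site 2)) e n).2 (hBE n)
  -- the position map: partial sums of the step lengths
  obtain ⟨Φ, hΦ0, hΦs⟩ : ∃ Φ : ℕ → ℕ, Φ 0 = 0 ∧ ∀ n, Φ (n + 1) = Φ n + L n :=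
    ⟨fun n => (Finset.range n).sum L, by simp, fun n => Finset.sum_range_succ _ _⟩
  have hmono : StrictMono Φ :=
    strictMono_nat_of_lt_succ fun n => by rw [hΦs]; exact Nat.lt_add_of_pos_right (hL0 n)
  -- simulation
  have hsim : ∀ n, btour (↑A : Set (Site 2)) ((M : ℤ) • e.1, e.2) (Φ n) =
      ((M : ℤ) • (btour (↑B : Set (Site 2)) e n).1, (btour (↑B : Set (Site 2)) e n).2) := by
    intro n
    induction n with
    | zero => rw [hΦ0, btour_zero, btour_zero]
    | succ n ih => rw [hΦs, btour_add, ih, hLend n, btour_succ, Prod.mk.eta]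
  -- every fine time below `Φ N` is an offset inside a simulated step
  have hdec : ∀ j, j < Φ N → ∃ n r, n < N ∧ r < L n ∧ j = Φ n + r := by
    intro j hj
    classical
    have hex : ∃ n, j < Φ (n + 1) := ⟨N - 1, by rwa [Nat.sub_add_cancel hN]⟩
    have h1 : j < Φ (Nat.find hex + 1) := Nat.find_spec hex
    have h2 : Φ (Nat.find hex) ≤ j := by
      rcases Nat.eq_zero_or_pos (Nat.find hex) with h0 | hpos
      · rw [h0, hΦ0]; exact Nat.zero_le _
      · have := Nat.find_min hex (m := Nat.find hex - 1) (by omega)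
        rw [Nat.sub_add_cancel hpos] at this
        omega
    have h3 : Nat.find hex < N := by
      by_contra hlt
      have := Nat.find_min hex (m := N - 1) (by omega)
      rw [Nat.sub_add_cancel hN] at this
      exact this hj
    rw [hΦs] at h1
    exact ⟨Nat.find hex, j - Φ (Nat.find hex), h3, by omega, by omega⟩
  refine ⟨Φ, hΦ0, hmono, bbt_isBEdge_scale hM hA he, hsim, by rw [hsim N, hper], ?_⟩
  intro j j' hj hj' hjj
  obtain ⟨n, r, hn, hr, rfl⟩ := hdec j hj
  obtain ⟨n', r', hn', hr', rfl⟩ := hdec j' hj'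
  rw [btour_add, hsim n, hLrun n r hr, btour_add, hsim n', hLrun n' r' hr'] at hjj
  obtain ⟨hx, hd, rfl⟩ :=
    bbt_nocollide (hBE n) (hBE n') (lt_of_lt_of_le hr (hLle n)) (lt_of_lt_of_le hr' (hLle n')) hjj
  rw [hinj n n' hn hn' (Prod.ext hx hd)]

end Summit.CriticalPhenomena.SAWScalingLimit.Theorems.FKGToTraversalBound.SlitNecklace

end
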